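import Literature.Computability.AlgebraicComplexity.HCBoolBand
import HarnessLib

/-!
# The Boolean band theorem: `HC(bandM A) = ∑_e per A(X, e)`

Second half of the Boolean band (`HCBoolBand.lean`): for a square matrix `A` over
`k ∪ {X_i} ∪ {Y_1, …, Y_t}` with at most one Boolean variable per row (`HCBand.RowProp`), the
Hamiltonian cycle sum of the band matrix `bandM A` over `k ∪ {X_i}` is the Boolean sum of the
permanents of `A`,

  `entryHC (bandM A) = ∑ e : Fin t → Bool, entryPer (boolSubst A e)`     (`HCBand.entryHC_bandM`),

over every commutative semiring `k` (the Hamiltonian-cycle analogue, valid in EVERY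
characteristic, of BCS 1997, Thm. (21.29); architecture of von zur Gathen 1987, Lemma 5.1 and
Thm. 5.6, gadgets re-derived, see the module docstring of `HCBoolBand.lean`). The
`VNP`-completeness of `HC` over every field is assembled from it in
`ValiantHCCompleteness.lean`.

## Proof

`HCBoolBand.lean` shows that the supported Hamiltonian cycles of the band are exactly the
structured covers `bperm ρ w` of the valid configurations `(ρ, w)` (`ρ` a permutation of the
rows — block `b` uses row `ρ b` —, `w` the set of chains that are off; `eq_bsucc`,
`valid_config`, `bperm`). Here:

* `tau`, `tau_lt_tau_bsucc`, `cycleType_bperm`: a potential increasing along `bperm` except on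
  the closing arc, so `bperm` is a single Hamiltonian cycle
  (`Equiv.Perm.cycleType_eq_card_of_potential`);
* `usePerm_bperm`, `switchW_bperm`: the configuration of `bperm ρ w` is `(ρ, w)` (with
  `eq_bsucc` this makes covers and valid configurations correspond bijectively);
* `prod_bandW_bsucc`: the weight of `bperm ρ w` is `∏_b roVal ρ b` (the used entries, Boolean
  variables set to `1`) times `2` for every variable without occurrences;
* `sum_valid_weight` / `sum_entryPer_boolSubst`: both sides equal
  `∑_ρ (∏_b roVal ρ b) ∏_j facF ρ j` with `facF ρ j = ∑_{e_j ∈ {0,1}} e_j^{m_j(ρ)}` (`= 2` if no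
  used entry is `Y_j`, `1` otherwise): on the band side the valid `w` form a product set
  (`valid_iff_mem_piFinset`, `Finset.prod_univ_sum`), on the permanent side the Boolean sum
  factors over the variables (`sum_prod_yv`);
* `entryHC_bandM`: unsupported permutations have a zero factor, and `Finset.sum_nbij'` along
  the correspondence.

## References

* J. von zur Gathen, *Feasible arithmetic computations: Valiant's hypothesis*, J. Symbolic
  Comput. 4 (1987) 137–172, §5, Lemma 5.1, Thm. 5.6.
* P. Bürgisser, M. Clausen, M. A. Shokrollahi, *Algebraic Complexity Theory*, Springer 1997,
  Thm. (21.17), Thm. (21.29).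
* L. G. Valiant, *Completeness classes in algebra*, Proc. 11th STOC (1979), 249–261.
-/

noncomputable section

namespace Literature.Computability.AlgebraicComplexity

namespace HCBand

universe u v

variable {N t : ℕ}

/-! ### The structured cover is Hamiltonian: a potential -/

section Potential

variable [NeZero N] {k : Type u} {σ : Type v} (A : Matrix (Fin N) (Fin N) (k ⊕ (σ ⊕ Fin t)))
variable (ρ : Equiv.Perm (Fin N)) (w : Fin t → Bool)

/-- Base potential of the bead `(a, b)`: beads are numbered along the thread (block by block,
row by row), eight units apart. [folklore] -/
def baseB (a b : Fin N) : ℕ := ((b : ℕ) * N + a) * 8 + 8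

/-- Base potential of the switch section, above all bead potentials. [folklore] -/
def baseS (N : ℕ) : ℕ := N * N * 8 + 16

/-- Offset of the bead node `i` inside its bead, according to the lane. [folklore] -/
def offB (a b : Fin N) (i : Fin 4) : ℕ :=
  if a < ρ b then (if i = 0 then 0 else if i = 2 then 1 else if i = 1 then 2 else 4)
  else if a = ρ b then (if i = 0 then 0 else if i = 3 then 2 else if i = 2 then 3 else 4)
  else (if i = 1 then 0 else if i = 3 then 2 else if i = 2 then 3 else 4)

/-- The potential along the structured cover: it increases along every arc of `bsucc` except
the closing arc `s_t → bead 0 0 0`. Inside a bead the order is that of its pattern; absorbed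
detour nodes and hubs sit inside their bead's range; the switch section and the chains that
are on sit above all beads, chain `j` between `s_j` and `s_{j+1}` in lexicographic order. [folklore] -/
def tau : Node N t → ℕ
  | .bead a b i => baseB a b + offB ρ a b i
  | .zed a b =>
      match A a b with
      | Sum.inr (Sum.inr j) =>
          if w j then baseB a b + (if a < ρ b then 3 else 1)
          else baseS N + (j : ℕ) * (N * N + 2) + 1 + ((a : ℕ) * N + b)
      | _ => baseB a b + (if a < ρ b then 3 else 1)
  | .hub a => baseB a (ρ.symm a) + 5
  | .sw j => baseS N + (j : ℕ) * (N * N + 2)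

variable {A ρ w}

omit [NeZero N] in
/-- `tau` of a bead node. [folklore] -/
theorem tau_bead (a b : Fin N) (i : Fin 4) : tau A ρ w (.bead a b i) = baseB a b + offB ρ a b i := rfl
omit [NeZero N] in
/-- `tau` of a hub. [folklore] -/
theorem tau_hub (a : Fin N) : tau A ρ w (.hub a) = baseB a (ρ.symm a) + 5 := rfl
omit [NeZero N] in
/-- `tau` of a switch node. [folklore] -/
theorem tau_sw (j : Fin (t + 1)) : tau A ρ w (.sw j) = baseS N + (j : ℕ) * (N * N + 2) := rfl

omit [NeZero N] in
/-- `tau` of a detour node that is absorbed. [folklore] -/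
theorem tau_zed_abs {a b : Fin N} (hz : zabs A w a b = true) :
    tau A ρ w (.zed a b) = baseB a b + (if a < ρ b then 3 else 1) := by
  simp only [tau]
  split
  · rename_i j hj
    rw [zabs_of_isY hj] at hz
    simp [hz]
  · rfl

omit [NeZero N] in
/-- `tau` of a detour node on a chain that is on. [folklore] -/
theorem tau_zed_chain {a b : Fin N} {j : Fin t} (hj : A a b = Sum.inr (Sum.inr j))
    (hw : w j = false) :
    tau A ρ w (.zed a b) = baseS N + (j : ℕ) * (N * N + 2) + 1 + ((a : ℕ) * N + b) := by
  simp only [tau]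
  rw [hj]
  simp [hw]

omit [NeZero N] in
/-- Offsets on lane 0. [folklore] -/
theorem offB_lt {a b : Fin N} (h : a < ρ b) (i : Fin 4) :
    offB ρ a b i = (if i = 0 then 0 else if i = 2 then 1 else if i = 1 then 2 else 4) := by
  simp [offB, h]
omit [NeZero N] in
/-- Offsets at the use row. [folklore] -/
theorem offB_eq {a b : Fin N} (h : a = ρ b) (i : Fin 4) :
    offB ρ a b i = (if i = 0 then 0 else if i = 3 then 2 else if i = 2 then 3 else 4) := by
  simp [offB, h]
omit [NeZero N] in
/-- Offsets on lane 1. [folklore] -/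
theorem offB_gt {a b : Fin N} (h : ρ b < a) (i : Fin 4) :
    offB ρ a b i = (if i = 1 then 0 else if i = 3 then 2 else if i = 2 then 3 else 4) := by
  simp [offB, not_lt.2 (le_of_lt h), ne_of_gt h]
omit [NeZero N] in
/-- Offsets are at most `4`. [folklore] -/
theorem offB_le (a b : Fin N) (i : Fin 4) : offB ρ a b i ≤ 4 := by
  unfold offB; split_ifs <;> omega

omit [NeZero N] in
/-- The rank `a N + b` of a position is below `N²`. [folklore] -/
theorem rank_lt (a b : Fin N) : (a : ℕ) * N + b + 1 ≤ N * N := by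
  have ha := a.isLt; have hb := b.isLt
  nlinarith

omit [NeZero N] in
/-- Lexicographic order is the order of ranks. [folklore] -/
theorem rank_lt_of_lt {p q : Lex (Fin N × Fin N)} (h : p < q) :
    ((ofLex p).1 : ℕ) * N + (ofLex p).2 < ((ofLex q).1 : ℕ) * N + (ofLex q).2 := by
  rcases Prod.Lex.lt_iff.1 h with h1 | ⟨h1, h2⟩
  · have hb := (ofLex p).2.isLt
    have h1' : ((ofLex p).1 : ℕ) + 1 ≤ (ofLex q).1 := h1
    nlinarith
  · have h1' : ((ofLex p).1 : ℕ) = (ofLex q).1 := congrArg Fin.val h1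
    have h2' : ((ofLex p).2 : ℕ) < (ofLex q).2 := h2
    nlinarith

omit [NeZero N] in
/-- All bead, hub and absorbed-detour potentials are below the switch section. [folklore] -/
theorem baseB_lt (a b : Fin N) : baseB a b + 5 < baseS N := by
  unfold baseB baseS
  have := rank_lt b a
  nlinarith [this]

/-- The potential of the lane-1 target after `(a, b)` exceeds `baseB a b + 5` (unless it is the
closing vertex). [folklore] -/
theorem tau_n1T {a b : Fin N} (hle : ρ b ≤ a) :
    baseB a b + 5 < tau A ρ w (n1T a b : Node N t) := by
  rcases n1T_shape (t := t) a b with ⟨a', ha', hn⟩ | ⟨ha, hn⟩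
  · rw [hn, tau_bead]
    have hlt : ρ b < a' := Fin.lt_def.2 (by have := Fin.le_def.1 hle; omega)
    rw [offB_gt hlt]
    unfold baseB
    simp only [Fin.isValue, ite_true]
    omega
  · rw [hn]
    rcases firstT_shape (t := t) b with ⟨b', hb', hf⟩ | ⟨hb, hf⟩
    · rw [hf, tau_bead]
      have hoff := offB_le (ρ := ρ) (0 : Fin N) b' 0
      have key : baseB a b + 5 < baseB (0 : Fin N) b' := by
        unfold baseB
        have : (b' : ℕ) * N = b * N + N := by rw [hb']; ring
        rw [this, Fin.val_zero]; omega
      omega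
    · rw [hf, tau_sw]
      have := baseB_lt (N := N) a b
      omega

/-- **The potential increases along the structured cover**, except on the closing arc into
`bead 0 0 0`. [cite: vonzurGathen1987, Thm. 5.6] -/
theorem tau_lt_tau_bsucc (hv : Valid A ρ w) (x : Node N t)
    (hx : bsucc A ρ w x ≠ .bead 0 0 0) : tau A ρ w x < tau A ρ w (bsucc A ρ w x) := by
  have hN : 0 < N := Nat.pos_of_ne_zero (NeZero.ne N)
  cases x with
  | bead a b i =>
    rw [tau_bead]
    fin_cases i <;> simp only [Fin.zero_eta, Fin.mk_one, Fin.reduceFinMk] at hx ⊢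
    · -- port 0
      rcases lt_trichotomy a (ρ b) with h | h | h
      · rw [bsucc_bead0_lt h, tau_bead, offB_lt h, offB_lt h]; simp
      · rw [bsucc_bead0_eq h] at hx ⊢
        rw [tau_zed_abs (by
          by_contra hz
          have hz' : zabs A w a b = false := by simpa using hz
          obtain ⟨j, hj, hwj⟩ := isY_of_zabs_false A hz'
          exact (hv j hwj).2 (toLex (a, b)) ((mem_occL A).2 hj) (by simpa using h.symm)),
          offB_eq h]
        simp [h]
      · rw [bsucc_bead0_gt h]
        have := tau_n1T (A := A) (w := w) (t := t) (le_of_lt h)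
        rw [offB_gt h]
        have h4 : (if (0 : Fin 4) = 1 then 0 else if (0 : Fin 4) = 3 then 2
            else if (0 : Fin 4) = 2 then 3 else 4) = 4 := by decide
        rw [h4]
        omega
    · -- port 1
      by_cases h : a = ρ b
      · rw [bsucc_bead1_eq h, tau_hub, offB_eq h]
        have hb : ρ.symm a = b := by rw [h]; simp
        rw [hb]; simp
      · by_cases hz : zabs A w a b = true
        · rw [bsucc_bead1_abs h hz, tau_zed_abs hz]
          rcases lt_or_gt_of_ne h with h' | h'
          · rw [offB_lt h']; simp [h']
          · rw [offB_gt h']; simp [not_lt.2 (le_of_lt h')]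
        · rw [bsucc_bead1_nabs h (by simpa using hz), tau_bead]
          rcases lt_or_gt_of_ne h with h' | h'
          · rw [offB_lt h', offB_lt h']; simp
          · rw [offB_gt h', offB_gt h']; simp
    · -- `p2`
      by_cases h : ρ b < a
      · rw [bsucc_bead2_gt h, tau_bead, offB_gt h, offB_gt h]; simp
      · rw [bsucc_bead2_le h, tau_bead]
        rcases lt_or_eq_of_le (not_lt.1 h) with h' | h'
        · rw [offB_lt h', offB_lt h']; simp
        · rw [offB_eq h', offB_eq h']; simp
    · -- `p3`
      by_cases h : a < ρ b
      · rw [bsucc_bead3_lt h] at hx ⊢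
        have ha : (a : ℕ) + 1 < N := lt_of_le_of_lt (Nat.succ_le_of_lt (Fin.lt_def.1 h)) (ρ b).isLt
        have hn0 : n0T a b = some (.bead ⟨a + 1, ha⟩ b 0 : Node N t) := by
          unfold n0T; rw [dif_pos ha]
        rw [hn0, Option.getD_some] at hx ⊢
        rw [tau_bead, offB_lt h]
        have hoff := offB_le (ρ := ρ) (⟨(a : ℕ) + 1, ha⟩ : Fin N) b 0
        unfold baseB
        simp only [Fin.isValue, Fin.reduceEq, if_false]
        omega
      · rw [bsucc_bead3_ge h, tau_bead]
        rcases lt_or_eq_of_le (not_lt.1 h) with h' | h'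
        · rw [offB_gt h', offB_gt h']; simp
        · rw [offB_eq h'.symm, offB_eq h'.symm]; simp
  | zed a b =>
    by_cases hz : zabs A w a b = true
    · rw [bsucc_zed_abs hz, tau_zed_abs hz, tau_bead]
      rcases lt_trichotomy a (ρ b) with h | h | h
      · rw [offB_lt h]; simp [h]
      · rw [offB_eq h]; simp [h]
      · rw [offB_gt h]; simp [not_lt.2 (le_of_lt h)]
    · have hz' : zabs A w a b = false := by simpa using hz
      obtain ⟨j, hj, hwj⟩ := isY_of_zabs_false A hz'
      have hq : toLex (a, b) ∈ occL A j := (mem_occL A).2 hj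
      rw [bsucc_zed_nabs hz', tau_zed_chain hj hwj]
      have hcs := chainSucc_eq_chainNext hq
      simp only [ofLex_toLex] at hcs
      rw [hcs, Option.getD_some]
      unfold chainNext
      cases hn : nextOcc A j (toLex (a, b)) with
      | none =>
        simp only [tau_sw, Fin.val_succ]
        have := rank_lt a b
        nlinarith [this]
      | some q' =>
        simp only [zedL]
        obtain ⟨hq'm, hlt, -⟩ := nextOcc_spec A hn
        rw [tau_zed_chain ((mem_occL A).1 hq'm) hwj]
        have := rank_lt_of_lt hlt
        simp only [ofLex_toLex] at this
        omega
  | hub a =>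
    rw [bsucc_hub, tau_hub]
    exact tau_n1T (by simp)
  | sw j =>
    rw [tau_sw]
    by_cases hjt : (j : ℕ) < t
    · have hjc : j = (⟨j, hjt⟩ : Fin t).castSucc := Fin.ext rfl
      by_cases hwj : w ⟨j, hjt⟩ = true
      · rw [hjc, bsucc_sw_true _ hwj]
        rcases swNext_shape (N := N) ((⟨j, hjt⟩ : Fin t).castSucc) with ⟨j', hj', h'⟩ | ⟨hjt', _⟩
        · rw [h', tau_sw]
          simp only [Fin.val_castSucc] at hj' ⊢
          rw [hj']
          nlinarith
        · simp at hjt'; omega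
      · have hw' : w ⟨j, hjt⟩ = false := by simpa using hwj
        rw [hjc, bsucc_sw_false _ hw']
        obtain ⟨hne, -⟩ := hv _ hw'
        have hcs : chainStart A (⟨j, hjt⟩ : Fin t).castSucc =
            some (zedL ((occL A ⟨j, hjt⟩).min' hne)) := by
          unfold chainStart
          rw [dif_pos (by exact hjt)]
          simp only [Fin.val_castSucc, firstOcc_eq_min' A hne, Option.map_some]
        rw [hcs, Option.getD_some, zedL,
          tau_zed_chain ((mem_occL A).1 (Finset.min'_mem _ hne)) hw']
        simp only [Fin.val_castSucc]
        omega
    · have hjl : j = Fin.last t := Fin.ext (by have := j.isLt; simp; omega)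
      subst hjl
      rw [bsucc_sw_last] at hx
      exfalso; apply hx
      unfold swNext
      rw [dif_neg (by simp)]

/-- **The structured cover is a Hamiltonian cycle.** [cite: vonzurGathen1987, Thm. 5.6] -/
theorem cycleType_bperm (hv : Valid A ρ w) :
    (bperm hv).cycleType = {Fintype.card (Node N t)} := by
  refine Equiv.Perm.cycleType_eq_card_of_potential (bperm hv) (.bead 0 0 0) (tau A ρ w)
    (fun x hx => tau_lt_tau_bsucc hv x hx) ?_
  rw [card_node]
  have : 1 ≤ N ^ 2 := Nat.one_le_pow _ _ (Nat.pos_of_ne_zero (NeZero.ne N))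
  omega

end Potential

/-! ### Round trip: the configuration of the structured cover -/

section RoundTrip

variable [NeZero N] {k : Type u} {σ : Type v} {A : Matrix (Fin N) (Fin N) (k ⊕ (σ ⊕ Fin t))}
variable {ρ : Equiv.Perm (Fin N)} {w : Fin t → Bool}

/-- The band has at least `6` vertices. [folklore] -/
theorem five_lt_card : 5 < Fintype.card (Node N t) := by
  rw [card_node]
  have : 1 ≤ N ^ 2 := Nat.one_le_pow _ _ (Nat.pos_of_ne_zero (NeZero.ne N))
  have : 1 ≤ N := Nat.pos_of_ne_zero (NeZero.ne N)
  omega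

/-- A supported Hamiltonian cycle of the band is a cover (no short returns). [cite: vonzurGathen1987, Thm. 5.6] -/
theorem isCover_of_cycleType {π : Equiv.Perm (Node N t)} (hs : ∀ x, adj A x (π x))
    (hπ : π.cycleType = {Fintype.card (Node N t)}) : IsCover A π := by
  have h5 := five_lt_card (N := N) (t := t)
  have key : ∀ m, 0 < m → m ≤ 4 → ∀ x, (π ^ m) x ≠ x := fun m hm0 hm x =>
    Equiv.Perm.pow_apply_ne_self_of_cycleType hπ hm0 (by omega) x
  refine ⟨hs, fun x => ?_, fun x => ?_, fun x => ?_⟩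
  · have := key 2 (by omega) (by omega) x; simpa [pow_succ, Equiv.Perm.mul_apply] using this
  · have := key 3 (by omega) (by omega) x; simpa [pow_succ, Equiv.Perm.mul_apply] using this
  · have := key 4 (by omega) (by omega) x; simpa [pow_succ, Equiv.Perm.mul_apply] using this

/-- The structured cover of a valid configuration is a cover. [cite: vonzurGathen1987, Thm. 5.6] -/
theorem isCover_bperm (hv : Valid A ρ w) : IsCover A (bperm hv) :=
  isCover_of_cycleType (fun x => adj_bsucc hv x) (cycleType_bperm hv)

/-- At the row `ρ b` of block `b` the structured cover is in the use pattern. [cite: vonzurGathen1987, Thm. 5.6] -/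
theorem patSpec_Uz_bperm (hv : Valid A ρ w) (b : Fin N) : PatSpec (bperm hv) (ρ b) b .Uz := by
  have hz : zabs A w (ρ b) b = true := by
    by_contra hz
    have hz' : zabs A w (ρ b) b = false := by simpa using hz
    obtain ⟨j, hj, hwj⟩ := isY_of_zabs_false A hz'
    exact (hv j hwj).2 (toLex (ρ b, b)) ((mem_occL A).2 hj) (by simp)
  refine ⟨?_, ?_, ?_, ?_, ?_⟩ <;> simp only [bperm_apply]
  · exact bsucc_bead0_eq rfl
  · exact bsucc_zed_abs hz
  · exact bsucc_bead3_ge (lt_irrefl _)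
  · exact bsucc_bead2_le (lt_irrefl _)
  · exact bsucc_bead1_eq rfl

/-- **Round trip I**: the use permutation of the structured cover is `ρ`. [cite: vonzurGathen1987, Thm. 5.6] -/
theorem usePerm_bperm (hrow : RowProp A) (hv : Valid A ρ w) :
    (isCover_bperm hv).usePerm hrow = ρ := by
  ext b
  change ((isCover_bperm hv).useRow hrow b : ℕ) = ρ b
  congr 1
  exact (isCover_bperm hv).use_unique hrow ((isCover_bperm hv).useRow_spec hrow b)
    (patSpec_Uz_bperm hv b)

/-- **Round trip II**: the switch configuration of the structured cover is `w`. [cite: vonzurGathen1987, Lemma 5.1] -/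
theorem switchW_bperm (hv : Valid A ρ w) : switchW (bperm hv) = w := by
  funext j
  unfold switchW
  simp only [bperm_apply]
  cases hw : w j with
  | true => exact decide_eq_true (bsucc_sw_true j hw)
  | false =>
    rw [decide_eq_false_iff_not, bsucc_sw_false j hw]
    obtain ⟨hne, -⟩ := hv j hw
    have hcs : chainStart A j.castSucc = some (zedL ((occL A j).min' hne)) := by
      unfold chainStart
      rw [dif_pos (by simp)]
      simp only [Fin.val_castSucc, Fin.eta, firstOcc_eq_min' A hne, Option.map_some]
    rw [hcs, Option.getD_some]
    rcases swNext_shape (N := N) j.castSucc with ⟨j', _, h'⟩ | ⟨_, h'⟩ <;> rw [h'] <;> simp [zedL]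

/-- **Round trip III**: a cover is the structured cover of its configuration. [cite: vonzurGathen1987, Thm. 5.6] -/
theorem bperm_config {π : Equiv.Perm (Node N t)} (hc : IsCover A π) (hrow : RowProp A) :
    bperm (fun j hj => hc.valid_config hrow j hj) = π := by
  ext x
  rw [bperm_apply]
  exact (hc.eq_bsucc hrow x).symm

end RoundTrip

/-! ### The weight of the structured cover -/

section Weight

variable [NeZero N] {k : Type u} [CommSemiring k] {σ : Type v}
variable {A : Matrix (Fin N) (Fin N) (k ⊕ (σ ⊕ Fin t))} {ρ : Equiv.Perm (Fin N)} {w : Fin t → Bool}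

open MvPolynomial

/-- The vertices of the band as a sum of products of `Fin`s. [folklore] -/
def nodeEquiv (N t : ℕ) :
    Node N t ≃ (Fin N × Fin N × Fin 4) ⊕ (Fin N × Fin N) ⊕ Fin N ⊕ Fin (t + 1) where
  toFun x := match x with
    | Node.bead a b i => Sum.inl (a, b, i)
    | Node.zed a b => Sum.inr (Sum.inl (a, b))
    | Node.hub a => Sum.inr (Sum.inr (Sum.inl a))
    | Node.sw j => Sum.inr (Sum.inr (Sum.inr j))
  invFun y := match y with
    | Sum.inl (a, b, i) => Node.bead a b i
    | Sum.inr (Sum.inl (a, b)) => Node.zed a b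
    | Sum.inr (Sum.inr (Sum.inl a)) => Node.hub a
    | Sum.inr (Sum.inr (Sum.inr j)) => Node.sw j
  left_inv x := by cases x <;> rfl
  right_inv y := by rcases y with ⟨a, b, i⟩ | ⟨a, b⟩ | a | j <;> rfl

omit [NeZero N] in
/-- A product over the vertices of the band, split by kinds. [folklore] -/
theorem prod_node {M : Type*} [CommMonoid M] (f : Node N t → M) :
    ∏ x, f x = (∏ a : Fin N, ∏ b : Fin N, ∏ i : Fin 4, f (.bead a b i)) *
      ((∏ a : Fin N, ∏ b : Fin N, f (.zed a b)) * ((∏ a, f (.hub a)) * ∏ j, f (.sw j))) := by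
  rw [Fintype.prod_equiv (nodeEquiv N t) f (fun y => f ((nodeEquiv N t).symm y))
    (fun x => by simp)]
  rw [Fintype.prod_sum_type, Fintype.prod_sum_type, Fintype.prod_sum_type,
    Fintype.prod_prod_type, Fintype.prod_prod_type]
  simp only [Fintype.prod_prod_type]
  rfl

/-- The weight of the use arc of block `b`: the value of the entry `A (ρ b) b`, with Boolean
variables set to `1`. [cite: vonzurGathen1987, Thm. 5.6] -/
def roVal (A : Matrix (Fin N) (Fin N) (k ⊕ (σ ⊕ Fin t))) (ρ : Equiv.Perm (Fin N)) (b : Fin N) :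
    MvPolynomial σ k :=
  entryVal (roWt (A (ρ b) b))

/-- The weight of the switch arc of `Y_j`: `2` on the direct arc of a variable without
occurrences, `1` otherwise. [cite: vonzurGathen1987, Lemma 5.1] -/
def swVal (A : Matrix (Fin N) (Fin N) (k ⊕ (σ ⊕ Fin t))) (w : Fin t → Bool) (j : Fin t) :
    MvPolynomial σ k :=
  if w j = true ∧ occL A j = ∅ then 2 else 1

omit [NeZero N] in
/-- `wt` off the use and switch arcs is `1`: bead nodes. [cite: vonzurGathen1987, Thm. 5.6] -/
theorem wt_bead_of_ne_hub (a b : Fin N) (i : Fin 4) {y : Node N t} (hy : ∀ a', y ≠ .hub a') :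
    wt A (.bead a b i) y = Sum.inl 1 := by
  cases y with
  | bead => rfl
  | zed => rfl
  | hub a' => exact absurd rfl (hy a')
  | sw => rfl

omit [NeZero N] in
/-- `wt` on a use arc. [cite: vonzurGathen1987, Thm. 5.6] -/
theorem wt_bead_hub (a b : Fin N) (i : Fin 4) (a' : Fin N) :
    wt A (.bead a b i) (.hub a') = roWt (A a b) := rfl

omit [NeZero N] in
/-- `wt` from a detour node is `1`. [cite: vonzurGathen1987, Thm. 5.6] -/
theorem wt_zed (a b : Fin N) (y : Node N t) : wt A (.zed a b) y = Sum.inl 1 := by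
  cases y <;> rfl

omit [NeZero N] in
/-- `wt` from a hub is `1`. [cite: vonzurGathen1987, Thm. 5.6] -/
theorem wt_hub (a : Fin N) (y : Node N t) : wt A (.hub a) y = Sum.inl 1 := by
  cases y <;> rfl

omit [NeZero N] in
/-- `wt` from a switch node to a non-switch node is `1`. [cite: vonzurGathen1987, Thm. 5.6] -/
theorem wt_sw_of_ne_sw (j : Fin (t + 1)) {y : Node N t} (hy : ∀ j', y ≠ .sw j') :
    wt A (.sw j) y = Sum.inl 1 := by
  cases y with
  | bead => rfl
  | zed => rfl
  | hub => rfl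
  | sw j' => exact absurd rfl (hy j')

omit [NeZero N] in
/-- `wt` between switch nodes. [cite: vonzurGathen1987, Lemma 5.1] -/
theorem wt_sw_sw (j j' : Fin (t + 1)) :
    wt A (.sw j) (.sw j') = if chainStart A j = none ∧ (j : ℕ) < t then Sum.inl 2 else Sum.inl 1 := rfl

/-- `bandW` on an arc is `wt`. [cite: vonzurGathen1987, Thm. 5.6] -/
theorem bandW_of_adj {x y : Node N t} (h : adj A x y) : bandW A x y = wt A x y := by
  unfold bandW; rw [if_pos h]

/-- `bandW` off the arcs is `0`. [cite: vonzurGathen1987, Thm. 5.6] -/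
theorem bandW_of_not_adj {x y : Node N t} (h : ¬ adj A x y) : bandW A x y = Sum.inl 0 := by
  unfold bandW; rw [if_neg h]

/-- **The weight of the structured cover**: the product of the used entries (Boolean
variables set to `1`) times `2` for every variable without occurrences. [cite: vonzurGathen1987, Thm. 5.6] -/
theorem prod_bandW_bsucc (hv : Valid A ρ w) :
    ∏ x : Node N t, entryVal (bandW A x (bsucc A ρ w x)) =
      (∏ b, roVal A ρ b) * ∏ j, swVal A w j := by
  have hadj : ∀ x, bandW A x (bsucc A ρ w x) = wt A x (bsucc A ρ w x) :=
    fun x => bandW_of_adj (adj_bsucc hv x)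
  simp only [hadj]
  rw [prod_node]
  -- beads: only the use arcs `bead (ρ b) b 1 → hub` carry a weight
  have hbead : ∀ a b i, entryVal (wt A (.bead a b i) (bsucc A ρ w (.bead a b i))) =
      (if a = ρ b ∧ i = 1 then roVal A ρ b else 1 : MvPolynomial σ k) := by
    intro a b i
    by_cases h : a = ρ b ∧ i = 1
    · obtain ⟨ha, rfl⟩ := h
      rw [if_pos ⟨ha, rfl⟩, bsucc_bead1_eq ha, wt_bead_hub, roVal, ← ha]
    · rw [if_neg h, wt_bead_of_ne_hub, entryVal_inl, C_1]
      -- a bead node mapping to a hub is port `1` at the use row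
      intro a' hy
      fin_cases i <;> simp only [Fin.zero_eta, Fin.mk_one, Fin.reduceFinMk] at hy h
      · rcases lt_trichotomy a (ρ b) with h' | h' | h'
        · rw [bsucc_bead0_lt h'] at hy; simp at hy
        · rw [bsucc_bead0_eq h'] at hy; simp at hy
        · rw [bsucc_bead0_gt h'] at hy; exact n1T_ne_hub _ _ _ hy
      · have h' : a ≠ ρ b := fun h' => h (by simp [h'])
        by_cases hz : zabs A w a b = true
        · rw [bsucc_bead1_abs h' hz] at hy; simp at hy
        · rw [bsucc_bead1_nabs h' (by simpa using hz)] at hy; simp at hy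
      · by_cases h' : ρ b < a
        · rw [bsucc_bead2_gt h'] at hy; simp at hy
        · rw [bsucc_bead2_le h'] at hy; simp at hy
      · by_cases h' : a < ρ b
        · rw [bsucc_bead3_lt h'] at hy
          have ha : (a : ℕ) + 1 < N :=
            lt_of_le_of_lt (Nat.succ_le_of_lt (Fin.lt_def.1 h')) (ρ b).isLt
          unfold n0T at hy; rw [dif_pos ha] at hy; simp at hy
        · rw [bsucc_bead3_ge h'] at hy; simp at hy
  have hbeads : (∏ a : Fin N, ∏ b : Fin N, ∏ i : Fin 4,
      entryVal (wt A (.bead a b i) (bsucc A ρ w (.bead a b i)))) = ∏ b, roVal A ρ b := by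
    simp only [hbead]
    rw [Finset.prod_comm]
    refine Finset.prod_congr rfl fun b _ => ?_
    rw [Fintype.prod_eq_single (ρ b) (fun a ha => by
      rw [Fintype.prod_eq_one]; intro i; rw [if_neg]; exact fun h => ha h.1)]
    rw [Fintype.prod_eq_single (1 : Fin 4) (fun i hi => by rw [if_neg]; exact fun h => hi h.2)]
    simp
  have hzeds : (∏ a : Fin N, ∏ b : Fin N, entryVal (wt A (.zed a b) (bsucc A ρ w (.zed a b)))) =
      (1 : MvPolynomial σ k) := by
    simp [wt_zed]
  have hhubs : (∏ a : Fin N, entryVal (wt A (.hub a) (bsucc A ρ w (.hub a)))) = (1 : MvPolynomial σ k) := by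
    simp [wt_hub]
  have hsws : (∏ j : Fin (t + 1), entryVal (wt A (.sw j) (bsucc A ρ w (.sw j)))) = ∏ j, swVal A w j := by
    rw [Fin.prod_univ_castSucc]
    have hlast : entryVal (wt A (.sw (Fin.last t)) (bsucc A ρ w (.sw (Fin.last t)))) =
        (1 : MvPolynomial σ k) := by
      rw [bsucc_sw_last, wt_sw_of_ne_sw, entryVal_inl, C_1]
      intro j' h
      have h1 := swNext_eq_sw h
      have h2 := j'.isLt
      simp at h1
      omega
    rw [hlast, mul_one]
    refine Finset.prod_congr rfl fun j _ => ?_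
    unfold swVal
    cases hw : w j with
    | true =>
      rw [bsucc_sw_true j hw]
      rcases swNext_shape (N := N) j.castSucc with ⟨j', _, h'⟩ | ⟨hjt, _⟩
      · rw [h', wt_sw_sw]
        simp only [Fin.val_castSucc, Fin.is_lt, and_true, true_and]
        by_cases he : occL A j = ∅
        · have hcs : chainStart A j.castSucc = none := by
            unfold chainStart; rw [dif_pos (by simp)]
            unfold firstOcc
            rw [dif_neg (by simp [Fin.val_castSucc, he])]
            rfl
          rw [if_pos hcs, if_pos he, entryVal_inl]
          simp [map_ofNat]
        · have hne : (occL A j).Nonempty := Finset.nonempty_iff_ne_empty.2 he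
          have hcs : chainStart A j.castSucc ≠ none := by
            unfold chainStart; rw [dif_pos (by simp)]
            simp [Fin.val_castSucc, firstOcc_eq_min' A hne]
          rw [if_neg hcs, if_neg he, entryVal_inl, C_1]
      · simp only [Fin.val_castSucc] at hjt
        exact absurd hjt (ne_of_lt j.isLt)
    | false =>
      rw [bsucc_sw_false j hw]
      obtain ⟨hne, -⟩ := hv j hw
      have hcs : chainStart A j.castSucc = some (zedL ((occL A j).min' hne)) := by
        unfold chainStart
        rw [dif_pos (by simp)]
        simp only [Fin.val_castSucc, Fin.eta, firstOcc_eq_min' A hne, Option.map_some]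
      rw [hcs, Option.getD_some, zedL, wt_sw_of_ne_sw _ (fun j' => by simp), entryVal_inl, C_1]
      simp
  rw [hbeads, hzeds, hhubs, hsws, one_mul, one_mul]

end Weight

/-! ### The main identity: `HC(bandM A) = ∑_e per A(X, e)` -/

section Main

variable [NeZero N] {k : Type u} [CommSemiring k] {σ : Type v}
variable (A : Matrix (Fin N) (Fin N) (k ⊕ (σ ⊕ Fin t)))

open MvPolynomial

/-- The number of blocks whose used entry is the Boolean variable `Y_j`. [cite: vonzurGathen1987, Lemma 5.1] -/
def mcount (ρ : Equiv.Perm (Fin N)) (j : Fin t) : ℕ := by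
  classical exact (Finset.univ.filter fun b : Fin N => A (ρ b) b = Sum.inr (Sum.inr j)).card

/-- The multiplicity factor of `Y_j` in the Boolean sum at the cover `ρ`: `2` if no used entry is
`Y_j` (the sum `∑_{e_j} e_j^0`), `1` otherwise (`∑_{e_j} e_j^m`, `m ≥ 1`). [cite: vonzurGathen1987, Lemma 5.1] -/
def facF (ρ : Equiv.Perm (Fin N)) (j : Fin t) : MvPolynomial σ k :=
  if mcount A ρ j = 0 then 2 else 1

/-- The switch weight as a function of the switch value. [cite: vonzurGathen1987, Lemma 5.1] -/
def swV (j : Fin t) (v : Bool) : MvPolynomial σ k :=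
  if v = true ∧ occL A j = ∅ then 2 else 1

omit [NeZero N] in
/-- `swVal` is `swV` at `w j`. [cite: vonzurGathen1987, Lemma 5.1] -/
theorem swVal_eq (w : Fin t → Bool) (j : Fin t) : swVal A w j = swV A j (w j) := rfl

/-- The allowed switch values at `ρ`: both if the chain of `Y_j` may be on, `true` only
otherwise. [cite: vonzurGathen1987, Lemma 5.1] -/
def allowed (ρ : Equiv.Perm (Fin N)) (j : Fin t) : Finset Bool := by
  classical exact
    if (occL A j).Nonempty ∧ ∀ q ∈ occL A j, ρ (ofLex q).2 ≠ (ofLex q).1 then Finset.univ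
    else {true}

omit [NeZero N] [CommSemiring k] in
/-- The valid switch configurations at `ρ` are the product of the allowed values. [cite: vonzurGathen1987, Lemma 5.1] -/
theorem valid_iff_mem_piFinset (ρ : Equiv.Perm (Fin N)) (w : Fin t → Bool) :
    Valid A ρ w ↔ w ∈ Fintype.piFinset (allowed A ρ) := by
  classical
  rw [Fintype.mem_piFinset]
  unfold Valid allowed
  constructor
  · intro h j
    split_ifs with hP
    · exact Finset.mem_univ _
    · cases hw : w j with
      | true => simp
      | false => exact absurd (h j hw) hP
  · intro h j hw
    have hj := h j
    split_ifs at hj with hP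
    · exact hP
    · rw [hw] at hj; simp at hj

omit [NeZero N] in
/-- **The switch side of the count**: summing the switch weights over the allowed values gives
the multiplicity factor. [cite: vonzurGathen1987, Lemma 5.1] -/
theorem sum_allowed_swV (ρ : Equiv.Perm (Fin N)) (j : Fin t) :
    ∑ v ∈ allowed A ρ j, swV A j v = facF A ρ j := by
  classical
  unfold allowed facF swV mcount
  by_cases hP : (occL A j).Nonempty ∧ ∀ q ∈ occL A j, ρ (ofLex q).2 ≠ (ofLex q).1
  · rw [if_pos hP]
    have hne : occL A j ≠ ∅ := Finset.nonempty_iff_ne_empty.1 hP.1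
    have hm : (Finset.univ.filter fun b : Fin N => A (ρ b) b = Sum.inr (Sum.inr j)).card = 0 := by
      rw [Finset.card_eq_zero, Finset.filter_eq_empty_iff]
      intro b _ hb
      exact hP.2 (toLex (ρ b, b)) ((mem_occL A).2 hb) (by simp)
    rw [hm, if_pos rfl, Fintype.sum_bool]
    simp [hne]
    norm_num
  · rw [if_neg hP, Finset.sum_singleton]
    simp only [true_and]
    by_cases he : occL A j = ∅
    · rw [if_pos he]
      have hm : (Finset.univ.filter fun b : Fin N => A (ρ b) b = Sum.inr (Sum.inr j)).card = 0 := by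
        rw [Finset.card_eq_zero, Finset.filter_eq_empty_iff]
        intro b _ hb
        have : toLex (ρ b, b) ∈ occL A j := (mem_occL A).2 hb
        rw [he] at this; simp at this
      rw [hm, if_pos rfl]
    · rw [if_neg he]
      have hne : (occL A j).Nonempty := Finset.nonempty_iff_ne_empty.2 he
      rw [not_and_or] at hP
      rcases hP with hP | hP
      · exact absurd hne hP
      · push Not at hP
        obtain ⟨q, hq, hρ⟩ := hP
        have hm : (Finset.univ.filter fun b : Fin N => A (ρ b) b = Sum.inr (Sum.inr j)).card ≠ 0 := by
          rw [Ne, Finset.card_eq_zero, Finset.filter_eq_empty_iff]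
          push Not
          refine ⟨(ofLex q).2, Finset.mem_univ _, ?_⟩
          rw [hρ]
          exact (mem_occL A).1 hq
        rw [if_neg hm]

/-- The Boolean factor of the entry at block `b` under the substitution `e`. [cite: BurgisserClausenShokrollahi1997, Thm. (21.29)] -/
def yv (ρ : Equiv.Perm (Fin N)) (b : Fin N) (e : Fin t → Bool) : MvPolynomial σ k :=
  match A (ρ b) b with
  | Sum.inr (Sum.inr j) => if e j then 1 else 0
  | _ => 1

omit [NeZero N] in
/-- The value of a substituted entry: the use weight times the Boolean factor. [cite: BurgisserClausenShokrollahi1997, Thm. (21.29)] -/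
theorem entryVal_boolSubstEntry (ρ : Equiv.Perm (Fin N)) (b : Fin N) (e : Fin t → Bool) :
    entryVal (boolSubstEntry e (A (ρ b) b)) = roVal A ρ b * yv A ρ b e := by
  unfold roVal yv roWt
  rcases hx : A (ρ b) b with c | i | j
  · simp [boolSubstEntry]
  · simp [boolSubstEntry]
  · simp only [boolSubstEntry, entryVal_inl, C_1, one_mul]
    split_ifs <;> simp

open Classical in
omit [NeZero N] in
/-- The Boolean factor as a product over the variables. [cite: BurgisserClausenShokrollahi1997, Thm. (21.29)] -/
theorem yv_eq_prod (ρ : Equiv.Perm (Fin N)) (b : Fin N) (e : Fin t → Bool) :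
    yv A ρ b e = ∏ j : Fin t,
      (if A (ρ b) b = Sum.inr (Sum.inr j) then (if e j then 1 else 0 : MvPolynomial σ k) else 1) := by
  classical
  unfold yv
  rcases hx : A (ρ b) b with c | i | j
  · simp
  · simp
  · rw [Fintype.prod_eq_single j (fun j' hj' => by
      rw [if_neg (fun h => hj' (Sum.inr_injective (Sum.inr_injective h)).symm)])]
    simp

omit [NeZero N] in
/-- **The permanent side of the count**: the Boolean sum of the Boolean factors of a cover is
the product of the multiplicity factors. [cite: vonzurGathen1987, Lemma 5.1] -/
theorem sum_prod_yv (ρ : Equiv.Perm (Fin N)) :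
    ∑ e : Fin t → Bool, ∏ b : Fin N, yv A ρ b e = ∏ j, facF A ρ j := by
  classical
  -- regroup the Boolean factors by variables
  have h1 : ∀ e : Fin t → Bool, ∏ b : Fin N, yv A ρ b e =
      ∏ j : Fin t, (if e j then 1 else 0 : MvPolynomial σ k) ^ mcount A ρ j := by
    intro e
    simp only [yv_eq_prod]
    rw [Finset.prod_comm]
    refine Finset.prod_congr rfl fun j _ => ?_
    rw [Finset.prod_ite, Finset.prod_const_one, mul_one, Finset.prod_const]
    rfl
  simp only [h1]
  -- sum over `e` of a product over `j` of functions of `e j`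
  have h2 := Finset.prod_univ_sum (fun _ : Fin t => (Finset.univ : Finset Bool))
    (fun j v => ((if v then 1 else 0 : MvPolynomial σ k) ^ mcount A ρ j))
  rw [Fintype.piFinset_univ] at h2
  rw [← h2]
  refine Finset.prod_congr rfl fun j _ => ?_
  rw [Fintype.sum_bool]
  unfold facF
  by_cases hm : mcount A ρ j = 0
  · simp [hm]; norm_num
  · simp [hm, zero_pow hm]

omit [NeZero N] in
/-- The permanent of a Boolean substitution, expanded by covers. [cite: BurgisserClausenShokrollahi1997, (21.12)] -/
theorem entryPer_boolSubst (e : Fin t → Bool) :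
    entryPer (boolSubst A e) = ∑ ρ : Equiv.Perm (Fin N), (∏ b, roVal A ρ b) * ∏ b, yv A ρ b e := by
  unfold entryPer boolSubst Matrix.permanent
  refine Finset.sum_congr rfl fun ρ _ => ?_
  rw [← Finset.prod_mul_distrib]
  refine Finset.prod_congr rfl fun b _ => ?_
  rw [Matrix.map_apply, Matrix.map_apply]
  exact entryVal_boolSubstEntry A ρ b e

omit [NeZero N] in
/-- **The right-hand side**: the Boolean sum of the permanents is
`∑_ρ (∏_b roVal ρ b) ∏_j facF ρ j`. [cite: vonzurGathen1987, Lemma 5.1] -/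
theorem sum_entryPer_boolSubst :
    ∑ e : Fin t → Bool, entryPer (boolSubst A e) =
      ∑ ρ : Equiv.Perm (Fin N), (∏ b, roVal A ρ b) * ∏ j, facF A ρ j := by
  simp only [entryPer_boolSubst]
  rw [Finset.sum_comm]
  refine Finset.sum_congr rfl fun ρ _ => ?_
  rw [← Finset.mul_sum, sum_prod_yv]

open Classical in
omit [NeZero N] in
/-- **The left-hand side over valid configurations**: summing the weights of the structured
covers over the valid configurations gives `∑_ρ (∏_b roVal ρ b) ∏_j facF ρ j`. [cite: vonzurGathen1987, Lemma 5.1] -/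
theorem sum_valid_weight :
    ∑ c ∈ (Finset.univ.filter fun c : Equiv.Perm (Fin N) × (Fin t → Bool) => Valid A c.1 c.2),
      (∏ b, roVal A c.1 b) * ∏ j, swVal A c.2 j =
      ∑ ρ : Equiv.Perm (Fin N), (∏ b, roVal A ρ b) * ∏ j, facF A ρ j := by
  classical
  rw [Finset.sum_filter, Fintype.sum_prod_type]
  refine Finset.sum_congr rfl fun ρ _ => ?_
  simp only
  rw [← Finset.sum_filter]
  have hWS : (Finset.univ.filter fun w : Fin t → Bool => Valid A ρ w) = Fintype.piFinset (allowed A ρ) := by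
    ext w
    simp only [Finset.mem_filter, Finset.mem_univ, true_and]
    exact valid_iff_mem_piFinset A ρ w
  rw [hWS, ← Finset.mul_sum]
  congr 1
  simp only [swVal_eq]
  rw [← Finset.prod_univ_sum (allowed A ρ) (fun j v => swV A j v)]
  exact Finset.prod_congr rfl fun j _ => sum_allowed_swV A ρ j

/-- **The Boolean band theorem.** For a matrix `A` over `k ∪ {X_i} ∪ {Y_1, …, Y_t}` with at
most one Boolean variable per row, the Hamiltonian cycle sum of the Boolean band `bandM A` is
the Boolean sum of the permanents of `A`:
`HC(bandM A) = ∑_{e ∈ {0,1}^t} per A(X, e)` (the `HC` analogue, over EVERY commutative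
semiring, of BCS 1997 Thm. (21.29); architecture of von zur Gathen 1987, Lemma 5.1 and
Thm. 5.6). [cite: vonzurGathen1987, Thm. 5.6] -/
theorem entryHC_bandM (hrow : RowProp A) :
    entryHC (bandM A) = ∑ e : Fin t → Bool, entryPer (boolSubst A e) := by
  classical
  rw [sum_entryPer_boolSubst, ← sum_valid_weight]
  unfold entryHC Matrix.hamiltonianCycleSum
  -- the weight of a permutation, as a product over the arcs `x → π x`
  have hterm : ∀ π : Equiv.Perm (Node N t),
      ∏ x, ((bandM A).map entryVal) (π x) x = ∏ x, entryVal (bandW A x (π x)) := by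
    intro π; rfl
  simp only [hterm]
  -- unsupported permutations contribute nothing
  have hsupp : (∑ π ∈ Finset.univ.filter (fun π : Equiv.Perm (Node N t) =>
        π.cycleType = {Fintype.card (Node N t)}), ∏ x, entryVal (bandW A x (π x))) =
      ∑ π ∈ Finset.univ.filter (fun π : Equiv.Perm (Node N t) =>
        π.cycleType = {Fintype.card (Node N t)} ∧ ∀ x, adj A x (π x)),
        ∏ x, entryVal (bandW A x (π x)) := by
    symm
    rw [← Finset.filter_filter, Finset.sum_filter]
    refine Finset.sum_congr rfl fun π _ => ?_
    split_ifs with h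
    · rfl
    · push Not at h
      obtain ⟨x, hx⟩ := h
      exact (Finset.prod_eq_zero (Finset.mem_univ x)
        (by rw [bandW_of_not_adj hx, entryVal_inl, C_0])).symm
  rw [hsupp]
  -- supported Hamiltonian cycles ↔ valid configurations
  let cfg : Equiv.Perm (Node N t) → Equiv.Perm (Fin N) × (Fin t → Bool) := fun π =>
    if h : IsCover A π then (h.usePerm hrow, switchW π) else (1, fun _ => true)
  let perm : Equiv.Perm (Fin N) × (Fin t → Bool) → Equiv.Perm (Node N t) := fun c =>
    if h : Valid A c.1 c.2 then bperm h else 1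
  have hcfg : ∀ π, ∀ h : IsCover A π, cfg π = (h.usePerm hrow, switchW π) := fun π h => by
    simp only [cfg, dif_pos h]
  have hperm : ∀ c, ∀ h : Valid A c.1 c.2, perm c = bperm h := fun c h => by
    simp only [perm, dif_pos h]
  refine Finset.sum_nbij' cfg perm ?_ ?_ ?_ ?_ ?_
  · -- `cfg` lands in the valid configurations
    intro π hπ
    simp only [Finset.mem_filter, Finset.mem_univ, true_and] at hπ ⊢
    have hc : IsCover A π := isCover_of_cycleType hπ.2 hπ.1
    rw [hcfg π hc]
    exact fun j hj => hc.valid_config hrow j hj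
  · -- `perm` lands in the supported Hamiltonian cycles
    intro c hc
    simp only [Finset.mem_filter, Finset.mem_univ, true_and] at hc ⊢
    rw [hperm c hc]
    exact ⟨cycleType_bperm hc, fun x => adj_bsucc hc x⟩
  · -- left inverse
    intro π hπ
    simp only [Finset.mem_filter, Finset.mem_univ, true_and] at hπ
    have hc : IsCover A π := isCover_of_cycleType hπ.2 hπ.1
    have hv : Valid A (hc.usePerm hrow) (switchW π) := fun j hj => hc.valid_config hrow j hj
    rw [hcfg π hc, hperm _ hv]
    ext x
    rw [bperm_apply]
    exact (hc.eq_bsucc hrow x).symm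
  · -- right inverse
    intro c hc
    simp only [Finset.mem_filter, Finset.mem_univ, true_and] at hc
    rw [hperm c hc, hcfg _ (isCover_bperm hc)]
    ext1
    · exact usePerm_bperm hrow hc
    · exact switchW_bperm hc
  · -- the weights agree
    intro π hπ
    simp only [Finset.mem_filter, Finset.mem_univ, true_and] at hπ
    have hc : IsCover A π := isCover_of_cycleType hπ.2 hπ.1
    have hv : Valid A (hc.usePerm hrow) (switchW π) := fun j hj => hc.valid_config hrow j hj
    rw [hcfg π hc]
    simp only
    rw [← prod_bandW_bsucc hv]
    refine Finset.prod_congr rfl fun x _ => ?_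
    rw [← hc.eq_bsucc hrow x]

end Main

end HCBand

end Literature.Computability.AlgebraicComplexity
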